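import Mathlib.Analysis.SpecialFunctions.Log.Basic
import Mathlib.Analysis.SpecialFunctions.Pow.Real
import Mathlib.Analysis.SpecialFunctions.Sqrt
import Mathlib.Algebra.Order.Chebyshev
import Mathlib.Data.Fin.Tuple.Basic
import HarnessLib

/-!
# The logarithmic Sobolev inequality on the biased discrete cube (finite sums)

Topic `Literature/Probability/Moments`. For the product Bernoulli measure `μ_p^{⊗n}` on the cube
`{0,1}^n` (`Fin n → Bool`, weight `w_p(x) = ∏ᵢ p^{xᵢ}(1-p)^{1-xᵢ}`), every `g : {0,1}^n → ℝ`
satisfies the **logarithmic Sobolev inequality**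
`Ent_p(g²) ≤ 2 Σᵢ E_p[(g(x^{i,1}) − g(x^{i,0}))²]` (`logSobolev`), where
`Ent_p(h) = E_p[h log h] − E_p[h] log E_p[h]` and `x^{i,b}` is `x` with the `i`-th bit set to `b`.
The constant `2` is crude (the sharp two-point constant is `(log((1−p)/p))/(1−2p) · p(1−p)`,
Diaconis–Saloff-Coste 1996, Thm. A.1 [DiaconisSaloffcoste1996]) but uniform in `p ∈ [0,1]`, which is what the
sharp-threshold application needs. Proof as in Ledoux's notes / Ané et al., *Sur les inégalités
de Sobolev logarithmiques* (SMF 2000), Ch. 1: the two-point inequality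
`Ent_p(a², b²) ≤ 2(a − b)²` (`twoPoint_logSobolev`, here from `log y ≤ y − 1` alone; Gross 1975 [Gross1975]), and
tensorisation by induction on `n` via the exact decomposition
`Ent_{n+1}(h) = E_b[Ent_n(h(b,·))] + Ent_p(m₁, m₀)`, `m_b = E_n[h(b,·)]`, the two-point inequality
applied to `√m_b = ‖g(b,·)‖₂` and the reverse triangle inequality in `L²(μ_p^{⊗n})`. Everything is
a finite sum; no measure theory.

## References

* L. Gross, *Logarithmic Sobolev inequalities*, Amer. J. Math. 97 (1975) 1061–1083 (two-point
  inequality and tensorisation).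
* P. Diaconis, L. Saloff-Coste, *Logarithmic Sobolev inequalities for finite Markov chains*,
  Ann. Appl. Probab. 6 (1996) 695–750, Thm. A.1 (sharp biased two-point constant).
* M. Ledoux, *The concentration of measure phenomenon*, AMS 2001, Ch. 5 (product entropy and
  tensorisation; background only).
-/

noncomputable section

namespace Literature.Probability.Moments

namespace BiasedCube

open Finset Real

variable {n : ℕ}

/-! ## The biased cube -/

/-- The one-bit weight: `p` on `true`, `1 − p` on `false`. [folklore] -/
def wt (p : ℝ) (b : Bool) : ℝ := if b then p else 1 - p

/-- The product weight `w_p(x) = ∏ᵢ wt p xᵢ` of a point of the cube. [folklore] -/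
def w (p : ℝ) (x : Fin n → Bool) : ℝ := ∏ i, wt p (x i)

/-- Expectation under `μ_p^{⊗n}`: `E_p[g] = Σ_x w_p(x) g(x)`. [folklore] -/
def Ep (p : ℝ) (g : (Fin n → Bool) → ℝ) : ℝ := ∑ x, w p x * g x

/-- The entropy functional `Ent_p(h) = E_p[h log h] − E_p[h] log E_p[h]`. [cite: Gross1975, §1 (entropy functional)] -/
def Ent (p : ℝ) (h : (Fin n → Bool) → ℝ) : ℝ :=
  Ep p (fun x => h x * Real.log (h x)) - Ep p h * Real.log (Ep p h)

/-- The squared discrete gradient in direction `i`, integrated: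
`E_p[(g(x^{i,1}) − g(x^{i,0}))²]`. [folklore] -/
def sqDiff (p : ℝ) (i : Fin n) (g : (Fin n → Bool) → ℝ) : ℝ :=
  Ep p (fun x => (g (Function.update x i true) - g (Function.update x i false)) ^ 2)

/-! ## Basic facts -/

/-- The weight of `true`. [folklore] -/
theorem wt_true (p : ℝ) : wt p true = p := rfl

/-- The weight of `false`. [folklore] -/
theorem wt_false (p : ℝ) : wt p false = 1 - p := rfl

/-- Weights are nonnegative for `p ∈ [0,1]`. [folklore] -/
theorem wt_nonneg {p : ℝ} (hp0 : 0 ≤ p) (hp1 : p ≤ 1) (b : Bool) : 0 ≤ wt p b := by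
  cases b <;> simp [wt] <;> linarith

/-- The one-bit weights sum to one. [folklore] -/
theorem sum_wt (p : ℝ) : ∑ b, wt p b = 1 := by
  rw [Fintype.sum_bool]; simp [wt]

/-- Product weights are nonnegative for `p ∈ [0,1]`. [folklore] -/
theorem w_nonneg {p : ℝ} (hp0 : 0 ≤ p) (hp1 : p ≤ 1) (x : Fin n → Bool) : 0 ≤ w p x :=
  Finset.prod_nonneg fun _ _ => wt_nonneg hp0 hp1 _

/-- `E_p` is linear. [folklore] -/
theorem Ep_add (p : ℝ) (g h : (Fin n → Bool) → ℝ) : Ep p (fun x => g x + h x) = Ep p g + Ep p h := by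
  simp only [Ep, mul_add, Finset.sum_add_distrib]

/-- `E_p` of a difference. [folklore] -/
theorem Ep_sub (p : ℝ) (g h : (Fin n → Bool) → ℝ) : Ep p (fun x => g x - h x) = Ep p g - Ep p h := by
  simp only [Ep, mul_sub, Finset.sum_sub_distrib]

/-- `E_p` is homogeneous. [folklore] -/
theorem Ep_smul (p c : ℝ) (g : (Fin n → Bool) → ℝ) : Ep p (fun x => c * g x) = c * Ep p g := by
  simp only [Ep, Finset.mul_sum]; refine Finset.sum_congr rfl fun x _ => by ring

/-- `E_p` is monotone for `p ∈ [0,1]`. [folklore] -/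
theorem Ep_mono {p : ℝ} (hp0 : 0 ≤ p) (hp1 : p ≤ 1) {g h : (Fin n → Bool) → ℝ} (hgh : ∀ x, g x ≤ h x) :
    Ep p g ≤ Ep p h :=
  Finset.sum_le_sum fun x _ => mul_le_mul_of_nonneg_left (hgh x) (w_nonneg hp0 hp1 x)

/-- `E_p` of a nonnegative function is nonnegative (`p ∈ [0,1]`). [folklore] -/
theorem Ep_nonneg {p : ℝ} (hp0 : 0 ≤ p) (hp1 : p ≤ 1) {g : (Fin n → Bool) → ℝ} (hg : ∀ x, 0 ≤ g x) : 0 ≤ Ep p g :=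
  Finset.sum_nonneg fun x _ => mul_nonneg (w_nonneg hp0 hp1 x) (hg x)

/-- **Slicing along the first coordinate**: `E_{n+1}[F] = p E_n[F(1,·)] + (1−p) E_n[F(0,·)]`. [folklore] -/
theorem Ep_succ (p : ℝ) (F : (Fin (n + 1) → Bool) → ℝ) :
    Ep p F = p * Ep p (fun y => F (Fin.cons true y)) + (1 - p) * Ep p (fun y => F (Fin.cons false y)) := by
  unfold Ep
  rw [← Fintype.sum_equiv (Fin.consEquiv fun _ => Bool) (fun q => w p (Fin.cons q.1 q.2) * F (Fin.cons q.1 q.2))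
    (fun x => w p x * F x) (fun q => rfl)]
  rw [Fintype.sum_prod_type, Fintype.sum_bool]
  simp only [w, Fin.prod_univ_succ, Fin.cons_zero, Fin.cons_succ, wt_true, wt_false, Finset.mul_sum]
  congr 1 <;> exact Finset.sum_congr rfl fun y _ => by ring

/-- Total mass one. [folklore] -/
theorem Ep_one (p : ℝ) : Ep p (fun _ : Fin n → Bool => (1 : ℝ)) = 1 := by
  induction n with
  | zero => simp [Ep, w]
  | succ n ih => rw [Ep_succ]; simp only [ih]; ring

/-- `E_p` of a constant. [folklore] -/
theorem Ep_const (p c : ℝ) : Ep p (fun _ : Fin n → Bool => c) = c := by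
  have := Ep_smul p c (fun _ : Fin n → Bool => (1 : ℝ))
  simp only [mul_one, Ep_one] at this
  exact this

/-! ## Entropy: two points -/

/-- `u log u − u log m = u log (u/m)` for `u ≥ 0`, `m > 0` (with `0 log 0 = 0`). [folklore] -/
theorem mul_log_sub_mul_log {u m : ℝ} (hu : 0 ≤ u) (hm : 0 < m) : u * Real.log u - u * Real.log m = u * Real.log (u / m) := by
  rcases hu.eq_or_lt with h | h
  · subst h; simp
  · rw [Real.log_div h.ne' hm.ne']; ring

/-- `u log(u/m) ≤ u (u/m − 1)` for `u ≥ 0`, `m > 0`. [folklore] -/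
theorem mul_log_div_le {u m : ℝ} (hu : 0 ≤ u) (hm : 0 < m) : u * Real.log (u / m) ≤ u * (u / m - 1) := by
  rcases hu.eq_or_lt with h | h
  · subst h; simp
  · exact mul_le_mul_of_nonneg_left (Real.log_le_sub_one_of_pos (div_pos h hm)) hu

/-- **The two-point logarithmic Sobolev inequality with constant `2`, any bias**: for
`0 ≤ p ≤ 1` and real `a, b`,
`p a² log a² + (1−p) b² log b² − m log m ≤ 2 (a − b)²`, `m = p a² + (1−p) b²`
(from `log y ≤ y − 1`: the left side is at most `p(1−p)(a² − b²)²/m`).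
[cite: Gross1975, two-point inequality (crude constant)] -/
theorem twoPoint_logSobolev {p : ℝ} (hp0 : 0 ≤ p) (hp1 : p ≤ 1) (a b : ℝ) :
    p * (a ^ 2 * Real.log (a ^ 2)) + (1 - p) * (b ^ 2 * Real.log (b ^ 2)) -
        (p * a ^ 2 + (1 - p) * b ^ 2) * Real.log (p * a ^ 2 + (1 - p) * b ^ 2) ≤
      2 * (a - b) ^ 2 := by
  set m := p * a ^ 2 + (1 - p) * b ^ 2 with hm
  have hm0 : 0 ≤ m := by positivity
  rcases hm0.eq_or_lt with hmz | hmpos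
  · -- `m = 0`: both weighted squares vanish
    have h1 : p * a ^ 2 = 0 := by nlinarith [mul_nonneg hp0 (sq_nonneg a), mul_nonneg (sub_nonneg.2 hp1) (sq_nonneg b)]
    have h2 : (1 - p) * b ^ 2 = 0 := by nlinarith [mul_nonneg hp0 (sq_nonneg a), mul_nonneg (sub_nonneg.2 hp1) (sq_nonneg b)]
    rw [← hmz, ← mul_assoc, ← mul_assoc, h1, h2]
    simp only [zero_mul, add_zero, Real.log_zero, mul_zero, sub_zero]
    positivity
  · have ha2 : 0 ≤ a ^ 2 := sq_nonneg a
    have hb2 : 0 ≤ b ^ 2 := sq_nonneg b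
    -- rewrite as `p a² log(a²/m) + (1-p) b² log(b²/m)`
    have hsplit : p * (a ^ 2 * Real.log (a ^ 2)) + (1 - p) * (b ^ 2 * Real.log (b ^ 2)) - m * Real.log m =
        p * (a ^ 2 * Real.log (a ^ 2 / m)) + (1 - p) * (b ^ 2 * Real.log (b ^ 2 / m)) := by
      rw [← mul_log_sub_mul_log ha2 hmpos, ← mul_log_sub_mul_log hb2 hmpos, hm]; ring
    rw [hsplit]
    have h1 := mul_le_mul_of_nonneg_left (mul_log_div_le ha2 hmpos) hp0
    have h2 := mul_le_mul_of_nonneg_left (mul_log_div_le hb2 hmpos) (sub_nonneg.2 hp1)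
    refine (add_le_add h1 h2).trans ?_
    -- `p a²(a²/m - 1) + (1-p) b²(b²/m - 1) = p(1-p)(a²-b²)²/m ≤ 2(a-b)²`
    have hid : p * (a ^ 2 * (a ^ 2 / m - 1)) + (1 - p) * (b ^ 2 * (b ^ 2 / m - 1)) =
        p * (1 - p) * (a ^ 2 - b ^ 2) ^ 2 / m := by
      field_simp
      rw [hm]; ring
    rw [hid, div_le_iff₀ hmpos]
    have hkey : p * (1 - p) * (a + b) ^ 2 ≤ 2 * m := by
      rw [hm]; nlinarith [mul_nonneg hp0 (sub_nonneg.2 hp1), sq_nonneg (a - b), hp0, sub_nonneg.2 hp1, ha2, hb2,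
        mul_nonneg hp0 ha2, mul_nonneg (sub_nonneg.2 hp1) hb2]
    have hfac : (a ^ 2 - b ^ 2) ^ 2 = (a - b) ^ 2 * (a + b) ^ 2 := by ring
    rw [hfac]
    nlinarith [hkey, sq_nonneg (a - b), mul_nonneg (mul_nonneg hp0 (sub_nonneg.2 hp1)) (sq_nonneg (a - b))]

/-! ## Entropy: decomposition along the first coordinate -/

/-- **Entropy decomposition**: `Ent_{n+1}(h) = E_b[Ent_n(h(b,·))] + Ent_p(m₁, m₀)` with
`m_b = E_n[h(b,·)]`. [folklore] -/
theorem Ent_succ (p : ℝ) (h : (Fin (n + 1) → Bool) → ℝ) :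
    Ent p h = (p * Ent p (fun y => h (Fin.cons true y)) + (1 - p) * Ent p (fun y => h (Fin.cons false y))) +
      (p * (Ep p (fun y => h (Fin.cons true y)) * Real.log (Ep p fun y => h (Fin.cons true y))) +
        (1 - p) * (Ep p (fun y => h (Fin.cons false y)) * Real.log (Ep p fun y => h (Fin.cons false y))) -
        Ep p h * Real.log (Ep p h)) := by
  unfold Ent
  rw [Ep_succ p (fun x => h x * Real.log (h x))]
  ring

/-! ## Weighted Cauchy–Schwarz and the reverse triangle inequality -/

/-- Weighted Cauchy–Schwarz: `E_p[u v]² ≤ E_p[u²] E_p[v²]`. [folklore] -/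
theorem Ep_mul_sq_le {p : ℝ} (hp0 : 0 ≤ p) (hp1 : p ≤ 1) (u v : (Fin n → Bool) → ℝ) :
    (Ep p fun x => u x * v x) ^ 2 ≤ Ep p (fun x => u x ^ 2) * Ep p (fun x => v x ^ 2) := by
  have h := Finset.sum_mul_sq_le_sq_mul_sq (Finset.univ : Finset (Fin n → Bool))
    (fun x => Real.sqrt (w p x) * u x) (fun x => Real.sqrt (w p x) * v x)
  have hw : ∀ x : Fin n → Bool, Real.sqrt (w p x) * Real.sqrt (w p x) = w p x :=
    fun x => Real.mul_self_sqrt (w_nonneg hp0 hp1 x)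
  have e1 : (Ep p fun x => u x * v x) = ∑ x, (Real.sqrt (w p x) * u x) * (Real.sqrt (w p x) * v x) := by
    refine Finset.sum_congr rfl fun x _ => ?_
    calc w p x * (u x * v x) = (Real.sqrt (w p x) * Real.sqrt (w p x)) * (u x * v x) := by rw [hw]
      _ = _ := by ring
  have e2 : (Ep p fun x => u x ^ 2) = ∑ x, (Real.sqrt (w p x) * u x) ^ 2 := by
    refine Finset.sum_congr rfl fun x _ => ?_
    rw [mul_pow, Real.sq_sqrt (w_nonneg hp0 hp1 x)]
  have e3 : (Ep p fun x => v x ^ 2) = ∑ x, (Real.sqrt (w p x) * v x) ^ 2 := by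
    refine Finset.sum_congr rfl fun x _ => ?_
    rw [mul_pow, Real.sq_sqrt (w_nonneg hp0 hp1 x)]
  rw [e1, e2, e3]
  exact h

/-- **Reverse triangle inequality in `L²(μ_p^{⊗n})`**:
`(‖u‖₂ − ‖v‖₂)² ≤ ‖u − v‖₂²`. [folklore] -/
theorem sq_sqrt_sub_sqrt_le {p : ℝ} (hp0 : 0 ≤ p) (hp1 : p ≤ 1) (u v : (Fin n → Bool) → ℝ) :
    (Real.sqrt (Ep p fun x => u x ^ 2) - Real.sqrt (Ep p fun x => v x ^ 2)) ^ 2 ≤ Ep p fun x => (u x - v x) ^ 2 := by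
  set A := Ep p fun x => u x ^ 2 with hA
  set B := Ep p fun x => v x ^ 2 with hB
  set C := Ep p fun x => u x * v x with hC
  have hA0 : 0 ≤ A := Ep_nonneg hp0 hp1 fun x => sq_nonneg _
  have hB0 : 0 ≤ B := Ep_nonneg hp0 hp1 fun x => sq_nonneg _
  have hCS : C ^ 2 ≤ A * B := Ep_mul_sq_le hp0 hp1 u v
  have hexp : (Ep p fun x => (u x - v x) ^ 2) = A + B - 2 * C := by
    have : (fun x => (u x - v x) ^ 2) = fun x => (u x ^ 2 + v x ^ 2) - 2 * (u x * v x) := by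
      funext x; ring
    rw [this, Ep_sub, Ep_add, Ep_smul]
  rw [hexp, sub_sq, Real.sq_sqrt hA0, Real.sq_sqrt hB0]
  have hsq : C ≤ Real.sqrt A * Real.sqrt B := by
    rw [← Real.sqrt_mul hA0]
    exact (le_abs_self C).trans (Real.abs_le_sqrt hCS)
  nlinarith [hsq]

/-! ## The gradient terms along the first coordinate -/

/-- Direction `0`: `sqDiff p 0 g = E_n[(g(1,·) − g(0,·))²]`. [folklore] -/
theorem sqDiff_zero (p : ℝ) (g : (Fin (n + 1) → Bool) → ℝ) :
    sqDiff p 0 g = Ep p fun y => (g (Fin.cons true y) - g (Fin.cons false y)) ^ 2 := by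
  unfold sqDiff
  rw [Ep_succ]
  simp only [Fin.update_cons_zero]
  ring

/-- Directions `i+1`: `sqDiff p i.succ g = p sqDiff p i g(1,·) + (1−p) sqDiff p i g(0,·)`. [folklore] -/
theorem sqDiff_succ (p : ℝ) (i : Fin n) (g : (Fin (n + 1) → Bool) → ℝ) :
    sqDiff p i.succ g = p * sqDiff p i (fun y => g (Fin.cons true y)) + (1 - p) * sqDiff p i (fun y => g (Fin.cons false y)) := by
  unfold sqDiff
  rw [Ep_succ]
  simp only [← Fin.cons_update]

/-! ## The logarithmic Sobolev inequality -/

/-- **Logarithmic Sobolev inequality on the biased cube** (constant `2`, uniform in `p ∈ [0,1]`):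
`Ent_p(g²) ≤ 2 Σᵢ E_p[(g(x^{i,1}) − g(x^{i,0}))²]`. Tensorisation of `twoPoint_logSobolev` by
induction on the dimension. [cite: Gross1975, §4 (product of two-point spaces)] [cite: DiaconisSaloffcoste1996, Thm. A.1 and Lemma 3.2 (sharp two-point constant, tensorisation)] -/
theorem logSobolev {p : ℝ} (hp0 : 0 ≤ p) (hp1 : p ≤ 1) :
    ∀ {n : ℕ} (g : (Fin n → Bool) → ℝ), Ent p (fun x => g x ^ 2) ≤ 2 * ∑ i, sqDiff p i g := by
  intro n
  induction n with
  | zero =>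
    intro g
    simp [Ent, Ep, w, sqDiff]
  | succ n ih =>
    intro g
    set gT : (Fin n → Bool) → ℝ := fun y => g (Fin.cons true y) with hgT
    set gF : (Fin n → Bool) → ℝ := fun y => g (Fin.cons false y) with hgF
    have hdec := Ent_succ p (fun x => g x ^ 2)
    set mT := Ep p fun y => g (Fin.cons true y) ^ 2 with hmT
    set mF := Ep p fun y => g (Fin.cons false y) ^ 2 with hmF
    have hmT0 : 0 ≤ mT := Ep_nonneg hp0 hp1 fun _ => sq_nonneg _
    have hmF0 : 0 ≤ mF := Ep_nonneg hp0 hp1 fun _ => sq_nonneg _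
    have hEp : Ep p (fun x => g x ^ 2) = p * mT + (1 - p) * mF := Ep_succ p _
    -- the two slices
    have hT := ih gT
    have hF := ih gF
    -- the two-point term
    have h2 := twoPoint_logSobolev hp0 hp1 (Real.sqrt mT) (Real.sqrt mF)
    rw [Real.sq_sqrt hmT0, Real.sq_sqrt hmF0] at h2
    have hrt := sq_sqrt_sub_sqrt_le hp0 hp1 gT gF
    -- assemble
    rw [hdec, hEp]
    have hsum : (∑ i : Fin (n + 1), sqDiff p i g) = sqDiff p 0 g + ∑ i : Fin n, sqDiff p i.succ g := Fin.sum_univ_succ _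
    rw [hsum, sqDiff_zero]
    simp only [sqDiff_succ]
    rw [Finset.sum_add_distrib, ← Finset.mul_sum, ← Finset.mul_sum]
    have hpT := mul_le_mul_of_nonneg_left hT hp0
    have hpF := mul_le_mul_of_nonneg_left hF (sub_nonneg.2 hp1)
    change p * Ent p (fun y => gT y ^ 2) + (1 - p) * Ent p (fun y => gF y ^ 2) +
      (p * (mT * Real.log mT) + (1 - p) * (mF * Real.log mF) - (p * mT + (1 - p) * mF) * Real.log (p * mT + (1 - p) * mF)) ≤
      2 * ((Ep p fun y => (gT y - gF y) ^ 2) + (p * ∑ i : Fin n, sqDiff p i gT + (1 - p) * ∑ i : Fin n, sqDiff p i gF))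
    nlinarith [hpT, hpF, h2, hrt]

end BiasedCube

end Literature.Probability.Moments

end
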